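import Literature.Probability.Percolation.BoxGatewayRarity
import Literature.Probability.Percolation.FiniteEnergy
import HarnessLib

/-!
# The exit gate of a box (solo seat `solo-CriticalPhenomena-informed`, portrait items S9/S15)

Combinatorial and measure-theoretic kit for `SoloInformedSurfaceTensionVanishes`: bond
percolation on `ℤ^d`, boxes `Λ(n) ⊆ Λ(N)`.

* `gate d n N ω ⊆ ∂ⁱⁿΛ(N)` — the boundary sites of `Λ(N)` joined to `Λ(n)` by an open path INSIDE
  `Λ(N)`; it only reads the edges inside `Λ(N)` (`determinedBy_gate_eq`).
* `exitEdges d N T`, `exitsClosed d N T` — the `≤ 2d|T|` edges leaving `Λ(N)` at `T`, and the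
  event that they are all closed; independent of the inside (`real_gate_eq_inter_exitsClosed`),
  of probability `≥ (1-p)^{2d|T|}` (`pow_le_real_exitsClosed`).
* `not_mem_boxToInfinity` — if the exits at the gate are closed, no site of `Λ(n)` percolates
  (`boxToInfinity d n = {Λ(n) ↔ ∞}`): an infinite open path from `Λ(n)` leaves `Λ(N)` through an
  edge whose inner end is, by then, in the gate.
* `markov_gate` — `(m+1) P(|gate| ≥ m+1) ≤ ∑_{v ∈ ∂ⁱⁿΛ(N)} P(v joined to Λ(n) inside Λ(N))`.
* `measure_linkedToBox_le_halfSpaceReach` — each summand is `≤ P_p(A_{N-n})`, the probability of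
  reaching height `N - n` from the apex of a half-space (lattice symmetry, as in
  `BoxGateway.measure_openConnVia_box_le_halfSpaceReach`; Cerf–Dembin 2020 §2 (eq1)).

The exit-closing mechanism is standard (e.g. arXiv:2603.03257, eq. (41) and Remark 8.2).
[folklore]
-/

noncomputable section

namespace Summit.CriticalPhenomena.PercolationContinuityZ3.Theorems

open MeasureTheory ProbabilityTheory Filter Topology
open Literature.Probability.Percolation Literature.Probability.LatticeModels
open Literature.Probability.Percolation.CerfDembinVanishing
open scoped ENNReal

namespace SurfaceTension

variable {d : ℕ}

/-! ## The events -/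

/-- `Λ(n) ↔ ∞`: some site of the box `Λ(n)` lies in an infinite open cluster. -/
def boxToInfinity (d n : ℕ) : Set (BondConfig (Site d)) :=
  {ω | ∃ x ∈ box d n, (openCluster ω x).Infinite}

/-- `v` is joined to some site of `Λ(n)` by an open path inside `Λ(N)`. -/
def linkedToBox (d n N : ℕ) (v : Site d) : Set (BondConfig (Site d)) :=
  ⋃ x ∈ box d n, openConnVia (withinGraph (zdGraph d) ↑(box d N)) v x

open scoped Classical in
/-- The gate `T_{n,N}(ω)`: the sites of `∂ⁱⁿΛ(N)` joined to `Λ(n)` inside `Λ(N)`. -/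
def gate (d n N : ℕ) (ω : BondConfig (Site d)) : Finset (Site d) :=
  (innerBoundary (zdGraph d) (box d N)).filter fun v => ω ∈ linkedToBox d n N v

/-- The edges of `ℤ^d` leaving `Λ(N)` at a site of `T`. -/
def exitEdges (d N : ℕ) (T : Finset (Site d)) : Finset (Sym2 (Site d)) :=
  T.biUnion fun v =>
    (((zdGraph d).neighborFinset v).filter fun w => w ∉ box d N).image fun w => s(v, w)

/-- All exit edges at `T` are closed. -/
def exitsClosed (d N : ℕ) (T : Finset (Site d)) : Set (BondConfig (Site d)) :=
  {ω | ∀ e ∈ exitEdges d N T, e ∉ ω}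

/-- Membership in `linkedToBox`, unfolded. -/
theorem mem_linkedToBox_iff {n N : ℕ} {v : Site d} {ω : BondConfig (Site d)} :
    ω ∈ linkedToBox d n N v ↔
      ∃ x ∈ box d n, x ∈ openClusterIn (withinGraph (zdGraph d) ↑(box d N)) ω v := by
  simp only [linkedToBox, Set.mem_iUnion, exists_prop, openConnVia, Set.mem_setOf_eq]

/-- Membership in `exitEdges`, unfolded. -/
theorem mem_exitEdges_iff {N : ℕ} {T : Finset (Site d)} {e : Sym2 (Site d)} :
    e ∈ exitEdges d N T ↔
      ∃ v ∈ T, ∃ w, ((zdGraph d).Adj v w ∧ w ∉ box d N) ∧ s(v, w) = e := by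
  simp only [exitEdges, Finset.mem_biUnion, Finset.mem_image, Finset.mem_filter,
    SimpleGraph.mem_neighborFinset]

/-- Membership in the gate, unfolded. -/
theorem mem_gate_iff {n N : ℕ} {ω : BondConfig (Site d)} {v : Site d} :
    v ∈ gate d n N ω ↔ v ∈ innerBoundary (zdGraph d) (box d N) ∧ ω ∈ linkedToBox d n N v := by
  classical
  simp only [gate, Finset.mem_filter]

/-- The gate lies in the inner vertex boundary of `Λ(N)`. -/
theorem gate_subset {n N : ℕ} (ω : BondConfig (Site d)) :
    gate d n N ω ⊆ innerBoundary (zdGraph d) (box d N) :=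
  fun _ hv => (mem_gate_iff.1 hv).1

/-! ## Combinatorics: closing the exits at the gate disconnects `Λ(n)` from infinity -/

/-- A walk leaving a set `R` has a first edge out of `R`, reached inside `R`. -/
theorem exists_exit_of_walk {V : Type*} {G H : SimpleGraph V} (hH : H ≤ G) (R : Set V) :
    ∀ {u v : V} (_ : H.Walk u v), u ∈ R → v ∉ R →
      ∃ b c, b ∈ R ∧ c ∉ R ∧ H.Adj b c ∧ (H ⊓ withinGraph G R).Reachable u b := by
  intro u v w
  induction w with
  | nil => intro hu hv; exact absurd hu hv
  | @cons a c _ hac w ih =>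
    intro ha hv
    by_cases hc : c ∈ R
    · obtain ⟨b, e, hb, he, hbe, hr⟩ := ih hc hv
      refine ⟨b, e, hb, he, hbe, (SimpleGraph.Adj.reachable ?_).trans hr⟩
      rw [SimpleGraph.inf_adj, withinGraph_adj]
      exact ⟨hac, hH hac, ha, hc⟩
    · exact ⟨a, c, ha, hc, hac, SimpleGraph.Reachable.refl _⟩

/-- If every exit edge at the gate is closed then no site of `Λ(n)` percolates. -/
theorem not_mem_boxToInfinity {n N : ℕ} (hnN : n ≤ N) {ω : BondConfig (Site d)}
    (hω : ω ⊆ (zdGraph d).edgeSet) (hclosed : ω ∈ exitsClosed d N (gate d n N ω)) :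
    ω ∉ boxToInfinity d n := by
  rintro ⟨x, hx, hinf⟩
  obtain ⟨y, hy, hyN⟩ := hinf.exists_notMem_finset (box d N)
  have hxN : x ∈ box d N := box_mono d hnN hx
  obtain ⟨w⟩ := (hy : (openGraph ω).Reachable x y)
  -- a configuration supported on `E(ℤ^d)` has its open graph inside `zdGraph d`
  have hle : openGraph ω ≤ zdGraph d := fun u v h =>
    (SimpleGraph.mem_edgeSet (zdGraph d)).1 (hω ((openGraph_adj ω u v).1 h).1)
  obtain ⟨b, c, hb, hc, hbc, hr⟩ :=
    exists_exit_of_walk hle (↑(box d N) : Set (Site d)) w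
      (Finset.mem_coe.2 hxN) (fun h => hyN (Finset.mem_coe.1 h))
  have hGadj : (zdGraph d).Adj b c := hle hbc
  have hb_gate : b ∈ gate d n N ω := by
    rw [mem_gate_iff, mem_innerBoundary_iff, mem_linkedToBox_iff]
    exact ⟨⟨Finset.mem_coe.1 hb, c, fun h => hc (Finset.mem_coe.2 h), hGadj⟩,
      x, hx, mem_openClusterIn_iff.2 hr.symm⟩
  have hedge : s(b, c) ∈ exitEdges d N (gate d n N ω) :=
    mem_exitEdges_iff.2 ⟨b, hb_gate, c, ⟨hGadj, fun h => hc (Finset.mem_coe.2 h)⟩, rfl⟩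
  rw [openGraph_adj] at hbc
  exact hclosed _ hedge hbc.1

/-! ## Measurability and independence -/

/-- `linkedToBox` only reads the edges inside `Λ(N)`. -/
theorem linkedToBox_inter_edgeSet {n N : ℕ} (ω : BondConfig (Site d)) (v : Site d) :
    ω ∩ (withinGraph (zdGraph d) ↑(box d N)).edgeSet ∈ linkedToBox d n N v ↔
      ω ∈ linkedToBox d n N v := by
  simp only [mem_linkedToBox_iff, openClusterIn_inter_edgeSet]

/-- The gate only reads the edges inside `Λ(N)`. -/
theorem gate_inter_edgeSet {n N : ℕ} (ω : BondConfig (Site d)) :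
    gate d n N (ω ∩ (withinGraph (zdGraph d) ↑(box d N)).edgeSet) = gate d n N ω := by
  ext v
  rw [mem_gate_iff, mem_gate_iff, linkedToBox_inter_edgeSet]

/-- The gate is determined by the edges inside `Λ(N)`. -/
theorem determinedBy_gate_eq {n N : ℕ} (T₀ : Finset (Site d)) :
    DeterminedBy {ω | gate d n N ω = T₀} (withinGraph (zdGraph d) ↑(box d N)).edgeSet := by
  rw [determinedBy_iff]
  intro ω ω' h
  simp only [Set.mem_setOf_eq]
  rw [← gate_inter_edgeSet ω, h, gate_inter_edgeSet]

/-- The exit edges lie outside `Λ(N)`'s edge set. -/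
theorem disjoint_edgeSet_exitEdges {N : ℕ} (T : Finset (Site d)) :
    Disjoint (withinGraph (zdGraph d) ↑(box d N)).edgeSet (↑(exitEdges d N T) : Set _) := by
  rw [Set.disjoint_left]
  intro e he he'
  rw [Finset.mem_coe, mem_exitEdges_iff] at he'
  obtain ⟨v, -, w, ⟨-, hw⟩, rfl⟩ := he'
  rw [mem_edgeSet_withinGraph] at he
  exact hw (Finset.mem_coe.1 he.2.2)

/-- At most `2d` exit edges per gate site. -/
theorem card_exitEdges_le {N : ℕ} (T : Finset (Site d)) :
    (exitEdges d N T).card ≤ 2 * d * T.card := by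
  calc (exitEdges d N T).card
      ≤ ∑ v ∈ T, ((((zdGraph d).neighborFinset v).filter fun w => w ∉ box d N).image
          fun w => s(v, w)).card := Finset.card_biUnion_le
    _ ≤ ∑ _v ∈ T, 2 * d := Finset.sum_le_sum fun v _ =>
        Finset.card_image_le.trans ((Finset.card_filter_le _ _).trans
          (card_neighborFinset_zdGraph_holds (d := d) v).le)
    _ = 2 * d * T.card := by rw [Finset.sum_const, smul_eq_mul]; ring

/-- `linkedToBox` is measurable. -/
theorem measurableSet_linkedToBox {n N : ℕ} (v : Site d) :
    MeasurableSet (linkedToBox d n N v) :=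
  MeasurableSet.biUnion (box d n).countable_toSet fun _ _ => measurableSet_openConnVia _ _ _

/-- The event `{gate = T₀}` as a finite Boolean combination of the events `linkedToBox v`. -/
theorem gate_eq_iff {n N : ℕ} {T₀ : Finset (Site d)} {ω : BondConfig (Site d)} :
    gate d n N ω = T₀ ↔ T₀ ⊆ innerBoundary (zdGraph d) (box d N) ∧
      ∀ v ∈ innerBoundary (zdGraph d) (box d N), (v ∈ T₀ ↔ ω ∈ linkedToBox d n N v) := by
  constructor
  · rintro rfl
    exact ⟨gate_subset ω, fun v hv => by rw [mem_gate_iff]; exact ⟨fun h => h.2, fun h => ⟨hv, h⟩⟩⟩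
  · rintro ⟨hsub, h⟩
    ext v
    rw [mem_gate_iff]
    exact ⟨fun hv => (h v hv.1).2 hv.2, fun hv => ⟨hsub hv, (h v (hsub hv)).1 hv⟩⟩

/-- `{gate = T₀}` is measurable. -/
theorem measurableSet_gate_eq {n N : ℕ} (T₀ : Finset (Site d)) :
    MeasurableSet {ω | gate d n N ω = T₀} := by
  by_cases hsub : T₀ ⊆ innerBoundary (zdGraph d) (box d N)
  · have hset : {ω | gate d n N ω = T₀} = ⋂ v ∈ innerBoundary (zdGraph d) (box d N),
        {ω | v ∈ T₀ ↔ ω ∈ linkedToBox d n N v} := by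
      ext ω
      simp only [Set.mem_setOf_eq, gate_eq_iff, hsub, true_and, Set.mem_iInter]
    rw [hset]
    refine MeasurableSet.biInter (Finset.countable_toSet _) fun v _ => ?_
    by_cases hv : v ∈ T₀
    · simp only [hv, true_iff, Set.setOf_mem_eq]; exact measurableSet_linkedToBox v
    · simp only [hv, false_iff]; exact (measurableSet_linkedToBox v).compl
  · have hset : {ω | gate d n N ω = T₀} = ∅ := by
      ext ω
      simp only [Set.mem_setOf_eq, Set.mem_empty_iff_false, iff_false]
      rintro rfl
      exact hsub (gate_subset ω)
    rw [hset]; exact MeasurableSet.empty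

/-- `exitsClosed` is measurable. -/
theorem measurableSet_exitsClosed {N : ℕ} (T : Finset (Site d)) :
    MeasurableSet (exitsClosed d N T) :=
  measurableSet_forall_notMem _

/-- `{gate = T₀}` (inside `Λ(N)`) and `{exits at T₀ closed}` (outside) are independent. -/
theorem real_gate_eq_inter_exitsClosed (p : unitInterval) {n N : ℕ} (T₀ : Finset (Site d)) :
    (bondPercolation (zdGraph d) p).real ({ω | gate d n N ω = T₀} ∩ exitsClosed d N T₀) =
      (bondPercolation (zdGraph d) p).real {ω | gate d n N ω = T₀} *
        (bondPercolation (zdGraph d) p).real (exitsClosed d N T₀) :=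
  bondPercolation_real_inter_of_disjoint (zdGraph d) p (disjoint_edgeSet_exitEdges T₀)
    (determinedBy_gate_eq T₀) (determinedBy_forall_notMem (exitEdges d N T₀))
    (measurableSet_gate_eq T₀) (measurableSet_forall_notMem _)

/-- Closing the `≤ 2d|T₀|` exits costs at least `(1-p)^{2d|T₀|}`. -/
theorem pow_le_real_exitsClosed (p : unitInterval) {N : ℕ} (T₀ : Finset (Site d)) :
    (1 - (p : ℝ)) ^ (2 * d * T₀.card) ≤
      (bondPercolation (zdGraph d) p).real (exitsClosed d N T₀) :=
  (pow_le_pow_of_le_one (sub_nonneg.2 p.2.2) (sub_le_self _ p.2.1) (card_exitEdges_le T₀)).trans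
    (le_bondPercolation_real_forall_notMem (zdGraph d) p (exitEdges d N T₀))

/-! ## The expected size of the gate -/

/-- `{|gate| ≤ m}` is the disjoint union of the events `{gate = T₀}`, `|T₀| ≤ m`. -/
theorem iUnion_gate_eq {n N : ℕ} (m : ℕ) :
    (⋃ T₀ ∈ (innerBoundary (zdGraph d) (box d N)).powerset.filter (fun T => T.card ≤ m),
        {ω : BondConfig (Site d) | gate d n N ω = T₀}) = {ω | (gate d n N ω).card ≤ m} := by
  ext ω
  simp only [Set.mem_iUnion, Set.mem_setOf_eq, exists_prop, Finset.mem_filter,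
    Finset.mem_powerset]
  constructor
  · rintro ⟨T₀, ⟨-, hcard⟩, rfl⟩; exact hcard
  · intro h; exact ⟨gate d n N ω, ⟨gate_subset ω, h⟩, rfl⟩

/-- `{|gate| ≤ m} = {|gate| ≥ m+1}ᶜ`. -/
theorem setOf_card_gate_eq_compl {n N : ℕ} (m : ℕ) :
    {ω : BondConfig (Site d) | (gate d n N ω).card ≤ m} =
      {ω | m + 1 ≤ (gate d n N ω).card}ᶜ := by
  ext ω
  simp only [Set.mem_setOf_eq, Set.mem_compl_iff, not_le]
  omega

/-- `|gate(ω)|` is the sum of the indicators of the events `linkedToBox v`, `v ∈ ∂ⁱⁿΛ(N)`. -/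
theorem card_gate_eq_sum {n N : ℕ} (ω : BondConfig (Site d)) :
    ((gate d n N ω).card : ℝ≥0∞) =
      ∑ v ∈ innerBoundary (zdGraph d) (box d N), (linkedToBox d n N v).indicator 1 ω := by
  classical
  rw [gate, Finset.card_filter, Nat.cast_sum]
  refine Finset.sum_congr rfl fun v _ => ?_
  by_cases hv : ω ∈ linkedToBox d n N v <;> simp [hv]

/-- That sum of indicators is measurable. -/
theorem measurable_sum_indicator (n N : ℕ) :
    Measurable fun ω : BondConfig (Site d) =>
      ∑ v ∈ innerBoundary (zdGraph d) (box d N),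
        (linkedToBox d n N v).indicator (1 : BondConfig (Site d) → ℝ≥0∞) ω :=
  Finset.measurable_sum _ fun v _ => measurable_one.indicator (measurableSet_linkedToBox v)

/-- `{|gate| ≥ m+1}` is measurable. -/
theorem measurableSet_card_gate_ge {n N : ℕ} (m : ℕ) :
    MeasurableSet {ω : BondConfig (Site d) | m + 1 ≤ (gate d n N ω).card} := by
  have hset : {ω : BondConfig (Site d) | m + 1 ≤ (gate d n N ω).card} =
      {ω | ((m + 1 : ℕ) : ℝ≥0∞) ≤ ∑ v ∈ innerBoundary (zdGraph d) (box d N),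
        (linkedToBox d n N v).indicator 1 ω} := by
    ext ω; simp only [Set.mem_setOf_eq, ← card_gate_eq_sum, Nat.cast_le]
  rw [hset]
  exact measurableSet_le measurable_const (measurable_sum_indicator n N)

/-- Markov: `(m+1) · P(|gate| ≥ m+1) ≤ ∑_{v ∈ ∂ⁱⁿΛ(N)} P(v joined to Λ(n) inside Λ(N))`. -/
theorem markov_gate (p : unitInterval) {n N : ℕ} (m : ℕ) :
    ((m + 1 : ℕ) : ℝ≥0∞) * bondPercolation (zdGraph d) p {ω | m + 1 ≤ (gate d n N ω).card} ≤
      ∑ v ∈ innerBoundary (zdGraph d) (box d N),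
        bondPercolation (zdGraph d) p (linkedToBox d n N v) := by
  have hmk := mul_meas_ge_le_lintegral (μ := bondPercolation (zdGraph d) p)
    (measurable_sum_indicator (d := d) n N) ((m + 1 : ℕ) : ℝ≥0∞)
  have hset : {ω : BondConfig (Site d) | ((m + 1 : ℕ) : ℝ≥0∞) ≤
      ∑ v ∈ innerBoundary (zdGraph d) (box d N), (linkedToBox d n N v).indicator 1 ω} =
      {ω | m + 1 ≤ (gate d n N ω).card} := by
    ext ω; simp only [Set.mem_setOf_eq, ← card_gate_eq_sum, Nat.cast_le]
  rw [hset] at hmk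
  refine hmk.trans_eq ?_
  rw [lintegral_finsetSum _ fun v _ => measurable_one.indicator (measurableSet_linkedToBox v)]
  exact Finset.sum_congr rfl fun v _ => lintegral_indicator_one (measurableSet_linkedToBox v)

/-! ## Symmetry: a boundary site joined to `Λ(n)` inside `Λ(N)` reaches height `N - n` in a half-space -/

/-- **`P_p(v joined to Λ(n) inside Λ(N)) ≤ P_p(A_{N-n})` for `v ∈ ∂ⁱⁿΛ(N)`**: the lattice
automorphism `y ↦ σ(y - v)` carrying `v` to `0` and `Λ(N)` into `ℍ` sends every site of `Λ(n)`
to height `≥ N - n` (Cerf–Dembin 2020 §2 (eq1) symmetry step; cf.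
`BoxGateway.measure_openConnVia_box_le_halfSpaceReach`). [folklore] -/
theorem measure_linkedToBox_le_halfSpaceReach [NeZero d] (p : unitInterval) {n N : ℕ}
    (hnN : n ≤ N) {w : Site d} (hw : w ∈ innerBoundary (zdGraph d) (box d N)) :
    bondPercolation (zdGraph d) p (linkedToBox d n N w) ≤
      bondPercolation (zdGraph d) p (halfSpaceReach d (N - n)) := by
  obtain ⟨i, hi⟩ := exists_eq_of_mem_innerBoundary_box hw
  -- the sign of the reflection
  obtain ⟨s, hsbox, hsx⟩ : ∃ s : ℤˣ, (∀ y ∈ box d N, 0 ≤ (s : ℤ) * (y i - w i)) ∧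
      ∀ x ∈ box d n, ((N - n : ℕ) : ℤ) ≤ (s : ℤ) * (x i - w i) := by
    have hcast : ((N - n : ℕ) : ℤ) = (N : ℤ) - n := by push_cast [Nat.cast_sub hnN]; ring
    rw [hcast]
    by_cases hwi : w i = (N : ℤ)
    · refine ⟨-1, fun y hy => ?_, fun x hx => ?_⟩
      · have := (mem_box.1 hy i).2
        rw [hwi]; push_cast; linarith
      · have := (mem_box.1 hx i).2
        rw [hwi]; push_cast; linarith
    · have hwi' : w i = -(N : ℤ) := hi.resolve_left hwi
      refine ⟨1, fun y hy => ?_, fun x hx => ?_⟩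
      · have := (mem_box.1 hy i).1
        rw [hwi']; push_cast; linarith
      · have := (mem_box.1 hx i).1
        rw [hwi']; push_cast; linarith
  -- the automorphism `ψ y = σ (y - w)`
  set π : Equiv.Perm (Fin d) := Equiv.swap i 0 with hπ
  set ψ : zdGraph d ≃g zdGraph d := (zdShiftIso (-w)).trans (zdSignedPermIso π fun _ => s) with hψ
  set e : Site d ≃ Site d := ψ.toEquiv with he
  have he_apply : ∀ y, e y = Site.signedPerm π (fun _ => s) (y + -w) := fun y => rfl
  have he0 : ∀ y, e y 0 = (s : ℤ) * (y i - w i) := fun y => by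
    rw [he_apply, Site.signedPerm_apply, hπ, Equiv.symm_swap, Equiv.swap_apply_right]
    simp [sub_eq_add_neg]
  have hew : e w = 0 := by rw [he_apply, add_neg_cancel, Site.signedPerm_zero]
  have hadj : ∀ u v, (zdGraph d).Adj (e u) (e v) ↔ (zdGraph d).Adj u v := fun u v => ψ.map_rel_iff'
  have hK : ∀ u v, (withinGraph (zdGraph d) (e '' ↑(box d N))).Adj (e u) (e v) ↔
      (withinGraph (zdGraph d) ↑(box d N)).Adj u v := fun u v => by
    simp only [withinGraph_adj, e.injective.mem_set_image, hadj u v]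
  have himg : e '' (↑(box d N) : Set (Site d)) ⊆ halfSpace d := by
    rintro _ ⟨y, hy, rfl⟩
    change 0 ≤ e y 0
    rw [he0]
    exact hsbox y hy
  -- the inclusion of events
  have hsub : linkedToBox d n N w ⊆ BondConfig.relabel (sym2Equiv e) ⁻¹' halfSpaceReach d (N - n) := by
    intro ω hω
    obtain ⟨x, hx, hxω⟩ := mem_linkedToBox_iff.1 hω
    have hrel := openClusterIn_relabel e hK ω w
    have hmem : e x ∈ openClusterIn (withinGraph (zdGraph d) (e '' ↑(box d N)))
        (BondConfig.relabel (sym2Equiv e) ω) 0 := by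
      have h := Set.mem_image_of_mem e hxω
      rwa [← hrel, hew] at h
    refine ⟨e x, openClusterIn_mono_graph (withinGraph_mono _ himg) _ 0 hmem, ?_⟩
    rw [he0]
    exact hsx x hx
  calc bondPercolation (zdGraph d) p (linkedToBox d n N w)
      ≤ bondPercolation (zdGraph d) p
          (BondConfig.relabel (sym2Equiv e) ⁻¹' halfSpaceReach d (N - n)) := measure_mono hsub
    _ = (bondPercolation (zdGraph d) p).map (BondConfig.relabel (sym2Equiv e))
          (halfSpaceReach d (N - n)) := (MeasurableEquiv.map_apply _ _).symm
    _ = bondPercolation (zdGraph d) p (halfSpaceReach d (N - n)) := by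
        rw [he, bondPercolation_map_relabel_iso ψ p]

end SurfaceTension

end Summit.CriticalPhenomena.PercolationContinuityZ3.Theorems
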